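import Summits.Ventures.CertifiedManyBodySolver.Downfold.RouterWindows
import HarnessLib

/-!
# The ROUTER WORD as a function of the box: verdicts, `undetermined (reason)`, soundness,
# inflation safety, hull rule

Venture CertifiedManyBodySolver, cell `pub/hubbard-downfold` (HUMAN RULINGS D-0096/D-0098: stage S1 =
DOWNFOLDING FRONT END = ROUTER), seat hubbard-downfold-mod-2; namespace
`Summit.Ventures.CertifiedManyBodySolver.Downfold.Router`. Everything here is PROVED. WHAT THIS IS
NOT: a certified statement about any material, a physics threshold, or the decision table of record
(`pub/hubbard-downfold/ROUTER.md` §3 / `router/router.py`); the cell's table is an INSTANCE of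
`route` below, and these theorems are what it inherits.

* §3 `route T S : Verdict` — the first firing row's word, else `noRow why candidates` with a BOX
  reason `why ∈ {missing c, straddles c, offTable}` (compute `c` / tighten `c` / no row applies
  anywhere on the box) and the words of the LIVE (non-excluded) rows as nearest candidates.
  Physics reasons (heavy fermion, multi-orbital, flat band, …) are ordinary rows whose word is an
  `UND:` token — stable verdicts, not box accidents. `route` is total and reads interval data only
  (provenance-blind by construction).
* §4 THEOREMS: `route_table_sound` (a table verdict holds at EVERY vector the box admits;
  `route_table_holdsOn` in `Downfold.HoldsOn` form for a `Downfold.Box`); `route_table_of_incl` —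
  INFLATION SAFETY: for a `Consistent` table, if an inflation of `S` is routed to `w` then so is `S`
  (widening a box never flips a verdict, it can only produce `noRow`; contrapositive
  `route_noRow_of_incl`); `consistent_of_separatedB` (decidable sufficient condition for
  consistency: rows with different words carry disjoint windows on a common coordinate);
  `route_hull` (a verdict on the referee hull is the verdict of both replays — "disagreement ⇒
  inflation, never a silent average" costs at most a `noRow`, never a wrong branch);
  `route_table_unique` (row order is immaterial to a table verdict); `route_offTable_sound` (no row
  holds at any admitted vector); `route_missing_sound` / `route_straddles_sound` (the reasons are
  truthful: `missing c` ⇒ `c` absent, `straddles c` ⇒ `c` present).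
-/

namespace Summit.Ventures.CertifiedManyBodySolver.Downfold

open NonemptyInterval

namespace Router

variable {ι : Type*} {K : Type*} [Field K] [LinearOrder K] [IsStrictOrderedRing K]

/-! ## §3 The router -/

/-- Why no row fired — a BOX reason, curable by more or tighter data. [folklore] -/
inductive BoxReason (ι : Type*)
  /-- a coordinate a live row needs is absent: compute it -/
  | missing (c : ι)
  /-- the box is present but too wide on `c` for a live row: tighten it -/
  | straddles (c : ι)
  /-- every row is excluded on the whole box: no row applies anywhere in it -/
  | offTable
  deriving DecidableEq, Repr

/-- The router's verdict: a table word, or `noRow` with its reason and the live candidates.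
[folklore] -/
inductive Verdict (ι ω : Type*)
  /-- a row fired: its word -/
  | table (w : ω)
  /-- no row fired: why, and the words of the rows not excluded on the box -/
  | noRow (why : BoxReason ι) (candidates : List ω)
  deriving DecidableEq, Repr

variable {ω : Type*}

/-- A table is CONSISTENT: rows that can hold at a common real vector emit the same word.
[folklore] -/
def Consistent (T : List (Row ι ω)) : Prop :=
  ∀ r ∈ T, ∀ r' ∈ T, ∀ p : ι → ℝ, r.Sat p → r'.Sat p → r.out = r'.out

/-- Decidable sufficient condition for consistency: pairwise separated unless equal words.
[folklore] -/
def separatedB [DecidableEq ι] [DecidableEq ω] (T : List (Row ι ω)) : Bool :=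
  T.all fun r => T.all fun r' => decide (r.out = r'.out) || r.separatedFrom r'

/-- A separated table is consistent. [folklore] -/
theorem consistent_of_separatedB [DecidableEq ι] [DecidableEq ω] {T : List (Row ι ω)}
    (h : separatedB T = true) : Consistent T := by
  intro r hr r' hr' p hp hp'
  unfold separatedB at h
  rw [List.all_eq_true] at h
  have h := h r hr
  rw [List.all_eq_true] at h
  have h := h r' hr'
  simp only [Bool.or_eq_true, decide_eq_true_eq] at h
  rcases h with h | h
  · exact h
  · exact absurd hp' (Row.separatedFrom_sound h hp)

/-- The reason a non-firing row reports: its first window not INSIDE sits on a missing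
coordinate (`missing`) or a present one (`straddles`); `offTable` only if the row fires. [folklore] -/
def Row.reason (r : Row ι ω) (S : Skel ι) : BoxReason ι :=
  match r.atoms.find? fun a => !(a.inside S) with
  | none => .offTable
  | some a =>
    match S a.coord with
    | none => .missing a.coord
    | some _ => .straddles a.coord

/-- A non-firing row never reports `offTable`. [folklore] -/
theorem Row.reason_ne_offTable {r : Row ι ω} {S : Skel ι} (h : ¬ r.fires S = true) :
    r.reason S ≠ .offTable := by
  unfold Row.reason
  rcases hf : r.atoms.find? (fun a => !(a.inside S)) with _ | a
  · rw [List.find?_eq_none] at hf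
    exfalso; apply h
    unfold Row.fires
    rw [List.all_eq_true]
    intro a ha
    simpa using hf a ha
  · rcases hS : S a.coord with _ | I <;> simp [hf, hS]

/-- A `missing c` report is truthful. [folklore] -/
theorem Row.reason_missing {r : Row ι ω} {S : Skel ι} {c : ι} (h : r.reason S = .missing c) :
    S c = none := by
  unfold Row.reason at h
  rcases hf : r.atoms.find? (fun a => !(a.inside S)) with _ | a
  · simp [hf] at h
  · simp only [hf] at h
    rcases hS : S a.coord with _ | I
    · simp only [hS, BoxReason.missing.injEq] at h
      rw [← h]; exact hS
    · simp [hS] at h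

/-- A `straddles c` report is truthful: `c` is present. [folklore] -/
theorem Row.reason_straddles {r : Row ι ω} {S : Skel ι} {c : ι} (h : r.reason S = .straddles c) :
    S c ≠ none := by
  unfold Row.reason at h
  rcases hf : r.atoms.find? (fun a => !(a.inside S)) with _ | a
  · simp [hf] at h
  · simp only [hf] at h
    rcases hS : S a.coord with _ | I
    · simp [hS] at h
    · simp only [hS, BoxReason.straddles.injEq] at h
      rw [← h, hS]; simp

/-- The LIVE rows on a box: those not excluded. [folklore] -/
def live (T : List (Row ι ω)) (S : Skel ι) : List (Row ι ω) := T.filter fun r => !(r.excludedB S)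

/-- A row outside the live list is excluded. [folklore] -/
theorem excludedB_of_not_mem_live {T : List (Row ι ω)} {S : Skel ι} {r : Row ι ω} (hr : r ∈ T)
    (h : r ∉ live T S) : r.excludedB S = true := by
  by_contra hne
  exact h (List.mem_filter.2 ⟨hr, by simpa using hne⟩)

/-- Diagnosis when no row fires: the first live row's reason and the live words; `offTable`
with no candidates when nothing is live. [folklore] -/
def diagnose (T : List (Row ι ω)) (S : Skel ι) : BoxReason ι × List ω :=
  match live T S with
  | [] => (.offTable, [])
  | r :: rs => (r.reason S, (r :: rs).map (·.out))

/-- **THE ROUTER**: the first firing row's word, else a diagnosed `noRow`; total, and a function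
of the interval data only (provenance-blind). [folklore] -/
def route (T : List (Row ι ω)) (S : Skel ι) : Verdict ι ω :=
  match T.find? fun r => r.fires S with
  | some r => .table r.out
  | none => .noRow (diagnose T S).1 (diagnose T S).2

/-- `route` when some row fires. [folklore] -/
private theorem route_of_find_some {T : List (Row ι ω)} {S : Skel ι} {r : Row ι ω}
    (hf : T.find? (fun r => r.fires S) = some r) : route T S = .table r.out := by
  simp [route, hf]

/-- `route` when no row fires. [folklore] -/
private theorem route_of_find_none {T : List (Row ι ω)} {S : Skel ι}
    (hf : T.find? (fun r => r.fires S) = none) :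
    route T S = .noRow (diagnose T S).1 (diagnose T S).2 := by
  simp [route, hf]

/-! ## §4 Theorems -/

/-- **A table verdict comes from a firing row, hence holds at EVERY admitted vector.**
[folklore] -/
theorem route_table_sound {T : List (Row ι ω)} {S : Skel ι} {w : ω} (h : route T S = .table w) :
    ∃ r ∈ T, r.out = w ∧ r.fires S = true ∧ ∀ p : ι → K, S.Mem p → r.Sat p := by
  rcases hf : T.find? (fun r => r.fires S) with _ | r
  · rw [route_of_find_none hf] at h
    exact absurd h (by simp)
  · rw [route_of_find_some hf, Verdict.table.injEq] at h
    have hrf : r.fires S = true := by simpa using List.find?_some hf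
    exact ⟨r, List.mem_of_find?_eq_some hf, h, hrf, fun p hp => Row.fires_sound hrf hp⟩

/-- The same in `HoldsOn` form for a parameter box: the firing row's conjunction of windows is a
word holding on the box. [folklore] -/
theorem route_table_holdsOn {T : List (Row ι ω)} {B : Box ι} {w : ω}
    (h : route T B.skel = .table w) :
    ∃ r ∈ T, r.out = w ∧ HoldsOn (fun p : ι → ℝ => r.Sat p) B := by
  obtain ⟨r, hrT, hrw, -, hsat⟩ := route_table_sound (K := ℝ) h
  exact ⟨r, hrT, hrw, fun p hp => hsat p ((B.mem_iff_skel_mem p).1 hp)⟩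

/-- **INFLATION SAFETY.** For a consistent table, if an inflation `S'` of `S` is routed to the
word `w`, so is `S`: widening a box never flips a verdict, it can only produce `noRow`. [folklore] -/
theorem route_table_of_incl {T : List (Row ι ω)} (hT : Consistent T) {S S' : Skel ι}
    (hSS' : S.Incl S') {w : ω} (h : route T S' = .table w) : route T S = .table w := by
  obtain ⟨r', hr'T, hr'w, hr'f, -⟩ := route_table_sound (K := ℝ) h
  have hrS : r'.fires S = true := Row.fires_mono hSS' hr'f
  rcases hf : T.find? (fun r => r.fires S) with _ | r
  · rw [List.find?_eq_none] at hf
    exact absurd hrS (by simpa using hf r' hr'T)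
  · rw [route_of_find_some hf, ← hr'w]
    have hrf : r.fires S = true := by simpa using List.find?_some hf
    exact congrArg Verdict.table (hT r (List.mem_of_find?_eq_some hf) r' hr'T (S.basePoint ℝ)
      (Row.fires_sound hrf S.basePoint_mem) (Row.fires_sound hrS S.basePoint_mem))

/-- Contrapositive: a `noRow` verdict persists under every inflation. [folklore] -/
theorem route_noRow_of_incl {T : List (Row ι ω)} (hT : Consistent T) {S S' : Skel ι}
    (hSS' : S.Incl S') {why : BoxReason ι} {cs : List ω} (h : route T S = .noRow why cs) :
    ∃ why' cs', route T S' = .noRow why' cs' := by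
  rcases h' : route T S' with w | ⟨why', cs'⟩
  · have := route_table_of_incl hT hSS' h'
    rw [h] at this
    exact absurd this (by simp)
  · exact ⟨why', cs', rfl⟩

/-- **HULL RULE** (referee disagreement ⇒ hull): a table verdict on the hull of two replays is
the verdict of each replay. [folklore] -/
theorem route_hull {T : List (Row ι ω)} (hT : Consistent T) (S₁ S₂ : Skel ι) {w : ω}
    (h : route T (S₁.hull S₂) = .table w) : route T S₁ = .table w ∧ route T S₂ = .table w :=
  ⟨route_table_of_incl hT (Skel.incl_hull_left S₁ S₂) h,
    route_table_of_incl hT (Skel.incl_hull_right S₁ S₂) h⟩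

/-- Row order is immaterial to a table verdict: every firing row emits the routed word.
[folklore] -/
theorem route_table_unique {T : List (Row ι ω)} (hT : Consistent T) {S : Skel ι} {w : ω}
    (h : route T S = .table w) {r : Row ι ω} (hr : r ∈ T) (hf : r.fires S = true) : r.out = w := by
  obtain ⟨r', hr'T, hr'w, -, hsat⟩ := route_table_sound (K := ℝ) h
  rw [← hr'w]
  exact hT r hr r' hr'T (S.basePoint ℝ) (Row.fires_sound hf S.basePoint_mem) (hsat _ S.basePoint_mem)

/-- A `noRow` verdict: no row fires, the reason is the diagnosis, the candidates are the live
words. [folklore] -/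
theorem route_noRow_sound {T : List (Row ι ω)} {S : Skel ι} {why : BoxReason ι} {cs : List ω}
    (h : route T S = .noRow why cs) :
    (∀ r ∈ T, ¬ r.fires S = true) ∧ (diagnose T S).1 = why ∧ cs = (live T S).map (·.out) := by
  rcases hf : T.find? (fun r => r.fires S) with _ | r
  · rw [route_of_find_none hf, Verdict.noRow.injEq] at h
    rw [List.find?_eq_none] at hf
    refine ⟨fun r hr => by simpa using hf r hr, h.1, ?_⟩
    rw [← h.2]
    rcases hl : live T S with _ | ⟨r, rs⟩ <;> simp [diagnose, hl]
  · rw [route_of_find_some hf] at h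
    exact absurd h (by simp)

/-- **`offTable` is certain**: no row holds at ANY admitted vector, and there are no candidates.
[folklore] -/
theorem route_offTable_sound {T : List (Row ι ω)} {S : Skel ι} {cs : List ω}
    (h : route T S = .noRow .offTable cs) :
    (∀ p : ι → K, S.Mem p → ∀ r ∈ T, ¬ r.Sat p) ∧ cs = [] := by
  obtain ⟨hnf, hwhy, hcs⟩ := route_noRow_sound h
  have hl : live T S = [] := by
    rcases hl : live T S with _ | ⟨r, rs⟩
    · rfl
    · exfalso
      have hd : diagnose T S = (r.reason S, (r :: rs).map (·.out)) := by simp [diagnose, hl]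
      rw [hd] at hwhy
      have hrT : r ∈ T :=
        (List.mem_filter.1 (show r ∈ live T S by rw [hl]; exact List.mem_cons_self)).1
      exact Row.reason_ne_offTable (hnf r hrT) hwhy
  refine ⟨fun p hp r hrT => ?_, by rw [hcs, hl]; rfl⟩
  exact Row.excludedB_sound (excludedB_of_not_mem_live hrT (by rw [hl]; simp)) hp

/-- **`missing c` is truthful**: the coordinate `c` is absent. [folklore] -/
theorem route_missing_sound {T : List (Row ι ω)} {S : Skel ι} {c : ι} {cs : List ω}
    (h : route T S = .noRow (.missing c) cs) : S c = none := by
  obtain ⟨-, hwhy, -⟩ := route_noRow_sound h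
  rcases hl : live T S with _ | ⟨r, rs⟩
  · simp [diagnose, hl] at hwhy
  · have hd : diagnose T S = (r.reason S, (r :: rs).map (·.out)) := by simp [diagnose, hl]
    rw [hd] at hwhy
    exact Row.reason_missing hwhy

/-- **`straddles c` is truthful**: `c` is present (the cure is tightening, not computing).
[folklore] -/
theorem route_straddles_sound {T : List (Row ι ω)} {S : Skel ι} {c : ι} {cs : List ω}
    (h : route T S = .noRow (.straddles c) cs) : S c ≠ none := by
  obtain ⟨-, hwhy, -⟩ := route_noRow_sound h
  rcases hl : live T S with _ | ⟨r, rs⟩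
  · simp [diagnose, hl] at hwhy
  · have hd : diagnose T S = (r.reason S, (r :: rs).map (·.out)) := by simp [diagnose, hl]
    rw [hd] at hwhy
    exact Row.reason_straddles hwhy

end Router

end Summit.Ventures.CertifiedManyBodySolver.Downfold
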